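import Summits.ResolutionOfSingularities.ResolutionOfSingularities.Theses.EquisingularLift
import Summits.ResolutionOfSingularities.ResolutionOfSingularities.Theorems.EquisingularLiftEquisingularLiftWittRing
import HarnessLib

/-!
# [OURS · L1 W4.5(b) · EL♮] CI-INST (conditional): the skeleton-v6 stub `stub_elnat_ciNoseThenPoints` from its two suppliers
(res-L1-w45b-lead-2 g1; crux `EquisingularLiftNat` stmt-20038 / child stmt-20148; line `sections`). NOT a statement of any manuscript; OURS plumbing.

`stub_elnat_ciNoseThenPoints_of_suppliers` = the REGISTERED stub (TARGET-CINOSE.lean 9810b78bf486e457 = skeleton v6 8e1301197c0a4270 / child v3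
d4233f6a873dd44b, text VERBATIM) with TWO hypotheses inserted after the locally-principal clause:
* (LIFT) = res-D-pv-027 AS res-L1-s36-pv-4's T-LIFT-CI in consumer form («OK as drafted» 08:50:16Z): over any complete DVR `O ↠ k` with
  algebraically closed residue field, homogeneous `f₁,…,f_c` with nonempty common zero set `Σ` satisfying the Jacobian-minor clause have an
  `O`-smooth centre `C ⊂ ℙⁿ_O` with `C.comap (Proj.map φ) = 𝓘(Σ)` for every `φ` over `π`;
* (HORIZ) = res-type-051's T-NOSE-THEN-POINTS `elNatBody_of_noseThenPoints` (p513523) with the HORIZONTAL conclusion (the sibling 051 is filing,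
  TAKING 08:53:47Z): hypotheses verbatim (smooth centre `C`, `¬ range ι ⊆ supp (C·𝒪_{ℙⁿ_k}) ⊆ range ι`, a blow-up of `ℙⁿ_k` along `C·𝒪_{ℙⁿ_k}`
  followed by a point-only resolution), conclusion = the horizontal `∃ (P', σ, S')` body of the stub for the given `φ`.
PROOF: `O := 𝕎(k)` (`stub_wittRing`), `C` from (LIFT), then (HORIZ) after rewriting `supp (C·𝒪_{ℙⁿ_k}) = Σ` (`coe_support_vanishingIdeal`).
So the registered stub is `fun … hci => stub_elnat_ciNoseThenPoints_of_suppliers … LIFT_thm HORIZ_thm hci` once both suppliers land.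
-/

set_option linter.dupNamespace false

open CategoryTheory AlgebraicGeometry TopologicalSpace
open AlgebraicGeometry.Scheme.IdealSheafData
open Summit.ResolutionOfSingularities.ResolutionOfSingularities.Cruxes.EquisingularLift.StrataSplit

namespace Summit.ResolutionOfSingularities.ResolutionOfSingularities.Cruxes.EquisingularLiftNat.Sections

/-- **CI-INST (conditional)**: the registered stub `stub_elnat_ciNoseThenPoints` modulo its two suppliers (LIFT) and (HORIZ) — see the module
docstring. [folklore; assembly] -/
theorem stub_elnat_ciNoseThenPoints_of_suppliers (p : ℕ) : p.Prime → ∀ (k : Type) [Field k] [CharP k p] [IsAlgClosed k] (n : ℕ) (H : AlgebraicGeometry.Scheme.{0}) (ι : H ⟶ (Literature.AlgebraicGeometry.Motives.projectiveSpace n k).left), AlgebraicGeometry.IsClosedImmersion ι → AlgebraicGeometry.IsIntegral H → (∀ y : (Literature.AlgebraicGeometry.Motives.projectiveSpace n k).left, ∃ U : (Literature.AlgebraicGeometry.Motives.projectiveSpace n k).left.affineOpens, y ∈ (U : (Literature.AlgebraicGeometry.Motives.projectiveSpace n k).left.Opens) ∧ (ι.ker.ideal U).IsPrincipal) → (∀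 (O : Type) [CommRing O] [IsDomain O] [IsDiscreteValuationRing O] [IsAdicComplete (IsLocalRing.maximalIdeal O) O] [IsAlgClosed (IsLocalRing.ResidueField O)] (π : O →+* k), Function.Surjective π → (letI := MvPolynomial.gradedAlgebra (σ := Fin (n + 1)) (R := O); letI := MvPolynomial.gradedAlgebra (σ := Fin (n + 1)) (R := k); ∀ (c : ℕ) (f : Fin c → MvPolynomial (Fin (n + 1)) k) (d : Fin c → ℕ), (∀ i, 1 ≤ d i ∧ f i ∈ MvPolynomial.homogeneousSubmodule (Fin (n + 1)) k (d i)) → Set.Nonempty {y : (Literature.AlgebraicGeometry.Motives.projectiveSpace n k).left | ∀ i, f i ∈ (y : ProjectiveSpectrum (MvPolynomial.homogeneousSubmodule (Fin (n + 1)) k)).asHomogeneousIdeal} → (∀ y ∈ {y : (Literature.AlgebraicGeometry.Motives.projectiveSpace n k).left | ∀ i, f i ∈ (y : ProjectiveSpectrum (MvPolynomial.homogeneousSubmodule (Fin (n + 1)) k)).asHomogeneousIdeal}, ∃ e : Fin c ↪ Fin (n + 1), Matrix.det (Matrix.of fun i j => MvPolynomial.pderiv (e j) (f i)) ∉ (y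 : ProjectiveSpectrum (MvPolynomial.homogeneousSubmodule (Fin (n + 1)) k)).asHomogeneousIdeal) → ∀ (hSig : IsClosed {y : (Literature.AlgebraicGeometry.Motives.projectiveSpace n k).left | ∀ i, f i ∈ (y : ProjectiveSpectrum (MvPolynomial.homogeneousSubmodule (Fin (n + 1)) k)).asHomogeneousIdeal}), ∃ C : (AlgebraicGeometry.Proj (MvPolynomial.homogeneousSubmodule (Fin (n + 1)) O)).IdealSheafData, AlgebraicGeometry.Smooth (CategoryTheory.CategoryStruct.comp C.subschemeι (CategoryTheory.CategoryStruct.comp (AlgebraicGeometry.Proj.toSpecZero (MvPolynomial.homogeneousSubmodule (Fin (n + 1)) O)) (AlgebraicGeometry.Spec.map (CommRingCat.ofHom (algebraMap O ((MvPolynomial.homogeneousSubmodule (Fin (n + 1)) O) 0)))))) ∧ ∀ (φ : (MvPolynomial.homogeneousSubmodule (Fin (n + 1)) O) →+*ᵍ (MvPolynomial.homogeneousSubmodule (Fin (n + 1)) k)) (hφ' : HomogeneousIdeal.irrelevant (MvPolynomial.homogeneousSubmodule (Fin (n + 1)) k) ≤ (HomogeneousIdeal.irrelevant (MvPolynomial.homogeneousSubmodule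 (Fin (n + 1)) O)).map φ), (∀ s, φ s = MvPolynomial.map π s) → C.comap (AlgebraicGeometry.Proj.map φ hφ') = AlgebraicGeometry.Scheme.IdealSheafData.vanishingIdeal (⟨{y : (Literature.AlgebraicGeometry.Motives.projectiveSpace n k).left | ∀ i, f i ∈ (y : ProjectiveSpectrum (MvPolynomial.homogeneousSubmodule (Fin (n + 1)) k)).asHomogeneousIdeal}, hSig⟩ : TopologicalSpace.Closeds (Literature.AlgebraicGeometry.Motives.projectiveSpace n k).left))) → (∀ (O : Type) [CommRing O] [IsDomain O] [IsDiscreteValuationRing O] [IsAdicComplete (IsLocalRing.maximalIdeal O) O] [IsAlgClosed (IsLocalRing.ResidueField O)] (π : O →+* k), Function.Surjective π → (letI := MvPolynomial.gradedAlgebra (σ := Fin (n + 1)) (R := O); letI := MvPolynomial.gradedAlgebra (σ := Fin (n + 1)) (R := k); ∀ (φ : (MvPolynomial.homogeneousSubmodule (Fin (n + 1)) O) →+*ᵍ (MvPolynomial.homogeneousSubmodule (Fin (n + 1)) k)) (hφ' : HomogeneousIdeal.irrelevant (MvPolynomial.homogeneousSubmodule (Fin (n + 1)) k) ≤ (HomogeneousIdeal.irrelevant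 (MvPolynomial.homogeneousSubmodule (Fin (n + 1)) O)).map φ), (∀ s, φ s = MvPolynomial.map π s) → ∀ (C : (AlgebraicGeometry.Proj (MvPolynomial.homogeneousSubmodule (Fin (n + 1)) O)).IdealSheafData), AlgebraicGeometry.Smooth (CategoryTheory.CategoryStruct.comp C.subschemeι (CategoryTheory.CategoryStruct.comp (AlgebraicGeometry.Proj.toSpecZero (MvPolynomial.homogeneousSubmodule (Fin (n + 1)) O)) (AlgebraicGeometry.Spec.map (CommRingCat.ofHom (algebraMap O ((MvPolynomial.homogeneousSubmodule (Fin (n + 1)) O) 0)))))) → ¬ (Set.range ι ⊆ (((C.comap (AlgebraicGeometry.Proj.map φ hφ')).support : Set (AlgebraicGeometry.Proj (MvPolynomial.homogeneousSubmodule (Fin (n + 1)) k))))) → (((C.comap (AlgebraicGeometry.Proj.map φ hφ')).support : Set (AlgebraicGeometry.Proj (MvPolynomial.homogeneousSubmodule (Fin (n + 1)) k)))) ⊆ Set.range ι → (∃ (F₂ : AlgebraicGeometry.Scheme.{0}) (υ : F₂ ⟶ (AlgebraicGeometry.Proj (MvPolynomial.homogeneousSubmodule (Fin (n + 1)) k))),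 Literature.AlgebraicGeometry.Resolution.IsBlowup υ (C.comap (AlgebraicGeometry.Proj.map φ hφ')) ∧ ∃ (F' : AlgebraicGeometry.Scheme.{0}) (ρ' : F' ⟶ F₂) (T' : Set F'), (∀ Q : (∀ F₁ : AlgebraicGeometry.Scheme.{0}, (F₁ ⟶ F₂) → Set F₁ → Prop), Q F₂ (CategoryTheory.CategoryStruct.id F₂) (closure (υ ⁻¹' (Set.range ι \ (((C.comap (AlgebraicGeometry.Proj.map φ hφ')).support : Set (AlgebraicGeometry.Proj (MvPolynomial.homogeneousSubmodule (Fin (n + 1)) k))))))) → (∀ (F₁ F₃ : AlgebraicGeometry.Scheme.{0}) (ρ : F₁ ⟶ F₂) (T₁ : Set F₁) (x : ↥((AlgebraicGeometry.Scheme.IdealSheafData.vanishingIdeal (⟨closure T₁, isClosed_closure⟩ : TopologicalSpace.Closeds F₁))).subscheme) (υ₁ : F₃ ⟶ F₁) (hx : IsClosed ({(((AlgebraicGeometry.Scheme.IdealSheafData.vanishingIdeal (⟨closure T₁, isClosed_closure⟩ : TopologicalSpace.Closeds F₁))).subschemeι x : F₁)} : Set F₁)), Q F₁ ρ T₁ →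 ¬ IsRegularLocalRing (((AlgebraicGeometry.Scheme.IdealSheafData.vanishingIdeal (⟨closure T₁, isClosed_closure⟩ : TopologicalSpace.Closeds F₁))).subscheme.presheaf.stalk x) → Literature.AlgebraicGeometry.Resolution.IsBlowup υ₁ (AlgebraicGeometry.Scheme.IdealSheafData.vanishingIdeal (⟨{(((AlgebraicGeometry.Scheme.IdealSheafData.vanishingIdeal (⟨closure T₁, isClosed_closure⟩ : TopologicalSpace.Closeds F₁))).subschemeι x : F₁)}, hx⟩ : TopologicalSpace.Closeds F₁)) → Q F₃ (CategoryTheory.CategoryStruct.comp υ₁ ρ) (closure (υ₁ ⁻¹' (T₁ \ {(((AlgebraicGeometry.Scheme.IdealSheafData.vanishingIdeal (⟨closure T₁, isClosed_closure⟩ : TopologicalSpace.Closeds F₁))).subschemeι x : F₁)})))) → Q F' ρ' T') ∧ Literature.AlgebraicGeometry.Resolution.Scheme.IsRegular (AlgebraicGeometry.Scheme.IdealSheafData.vanishingIdeal (⟨closure T', isClosed_closure⟩ : TopologicalSpace.Closeds F')).subscheme) → ∀ Y : Set (AlgebraicGeometry.Proj (MvPolynomial.homogeneousSubmodule (Fin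 (n + 1)) O)), Y = Set.range (CategoryTheory.CategoryStruct.comp ι (AlgebraicGeometry.Proj.map φ hφ') : H ⟶ (AlgebraicGeometry.Proj (MvPolynomial.homogeneousSubmodule (Fin (n + 1)) O))) → ∃ (P' : AlgebraicGeometry.Scheme.{0}) (σ : P' ⟶ (AlgebraicGeometry.Proj (MvPolynomial.homogeneousSubmodule (Fin (n + 1)) O))) (S' : Set P'), (∀ Q : (∀ X' : AlgebraicGeometry.Scheme.{0}, (X' ⟶ (AlgebraicGeometry.Proj (MvPolynomial.homogeneousSubmodule (Fin (n + 1)) O))) → Set X' → Prop), Q (AlgebraicGeometry.Proj (MvPolynomial.homogeneousSubmodule (Fin (n + 1)) O)) (CategoryTheory.CategoryStruct.id (AlgebraicGeometry.Proj (MvPolynomial.homogeneousSubmodule (Fin (n + 1)) O))) Y → (∀ (X' X'' : AlgebraicGeometry.Scheme.{0}) (σ' : X' ⟶ (AlgebraicGeometry.Proj (MvPolynomial.homogeneousSubmodule (Fin (n + 1)) O))) (Y' : Set X') (C : X'.IdealSheafData) (τ : X'' ⟶ X'), Q X' σ' Y' → Literature.AlgebraicGeometry.Resolution.IsBlowup τ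 C → Literature.AlgebraicGeometry.Resolution.Scheme.IsRegular C.subscheme → AlgebraicGeometry.Flat (CategoryTheory.CategoryStruct.comp C.subschemeι (CategoryTheory.CategoryStruct.comp σ' (CategoryTheory.CategoryStruct.comp (AlgebraicGeometry.Proj.toSpecZero (MvPolynomial.homogeneousSubmodule (Fin (n + 1)) O)) (AlgebraicGeometry.Spec.map (CommRingCat.ofHom (algebraMap O (MvPolynomial.homogeneousSubmodule (Fin (n + 1)) O 0))))))) → σ' '' (C.support : Set X') ⊆ {x | ¬ IsGenericPoint x Y} → (C.support : Set X') ∩ (CategoryTheory.CategoryStruct.comp σ' (CategoryTheory.CategoryStruct.comp (AlgebraicGeometry.Proj.toSpecZero (MvPolynomial.homogeneousSubmodule (Fin (n + 1)) O)) (AlgebraicGeometry.Spec.map (CommRingCat.ofHom (algebraMap O (MvPolynomial.homogeneousSubmodule (Fin (n + 1)) O 0)))))) ⁻¹' {IsLocalRing.closedPoint O} ⊆ Y' → Q X'' (CategoryTheory.CategoryStruct.comp τ σ') (closure (τ ⁻¹' (Y' \ (C.support : Set X'))))) → Q P' σ S') ∧ Literature.AlgebraicGeometry.Resolution.Scheme.IsRegular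 (AlgebraicGeometry.Scheme.IdealSheafData.vanishingIdeal (⟨closure S', isClosed_closure⟩ : TopologicalSpace.Closeds P')).subscheme)) → (letI := MvPolynomial.gradedAlgebra (σ := Fin (n + 1)) (R := k); ∃ (c : ℕ) (f : Fin c → MvPolynomial (Fin (n + 1)) k) (d : Fin c → ℕ), (∀ i, 1 ≤ d i ∧ f i ∈ MvPolynomial.homogeneousSubmodule (Fin (n + 1)) k (d i)) ∧ Set.Nonempty {y : (Literature.AlgebraicGeometry.Motives.projectiveSpace n k).left | ∀ i, f i ∈ (y : ProjectiveSpectrum (MvPolynomial.homogeneousSubmodule (Fin (n + 1)) k)).asHomogeneousIdeal} ∧ {y : (Literature.AlgebraicGeometry.Motives.projectiveSpace n k).left | ∀ i, f i ∈ (y : ProjectiveSpectrum (MvPolynomial.homogeneousSubmodule (Fin (n + 1)) k)).asHomogeneousIdeal} ⊆ Set.range ι ∧ ¬ (Set.range ι ⊆ {y : (Literature.AlgebraicGeometry.Motives.projectiveSpace n k).left | ∀ i, f i ∈ (y : ProjectiveSpectrum (MvPolynomial.homogeneousSubmodule (Fin (n + 1)) k)).asHomogeneousIdeal}) ∧ (∀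 y ∈ {y : (Literature.AlgebraicGeometry.Motives.projectiveSpace n k).left | ∀ i, f i ∈ (y : ProjectiveSpectrum (MvPolynomial.homogeneousSubmodule (Fin (n + 1)) k)).asHomogeneousIdeal}, ∃ e : Fin c ↪ Fin (n + 1), Matrix.det (Matrix.of fun i j => MvPolynomial.pderiv (e j) (f i)) ∉ (y : ProjectiveSpectrum (MvPolynomial.homogeneousSubmodule (Fin (n + 1)) k)).asHomogeneousIdeal) ∧ ∃ (hSig : IsClosed {y : (Literature.AlgebraicGeometry.Motives.projectiveSpace n k).left | ∀ i, f i ∈ (y : ProjectiveSpectrum (MvPolynomial.homogeneousSubmodule (Fin (n + 1)) k)).asHomogeneousIdeal}) (F₂ : AlgebraicGeometry.Scheme.{0}) (υ : F₂ ⟶ (Literature.AlgebraicGeometry.Motives.projectiveSpace n k).left), Literature.AlgebraicGeometry.Resolution.IsBlowup υ (AlgebraicGeometry.Scheme.IdealSheafData.vanishingIdeal (⟨{y : (Literature.AlgebraicGeometry.Motives.projectiveSpace n k).left | ∀ i, f i ∈ (y : ProjectiveSpectrum (MvPolynomial.homogeneousSubmodule (Fin (n + 1)) k)).asHomogeneousIdeal},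 hSig⟩ : TopologicalSpace.Closeds (Literature.AlgebraicGeometry.Motives.projectiveSpace n k).left)) ∧ ∃ (F' : AlgebraicGeometry.Scheme.{0}) (ρ' : F' ⟶ F₂) (T' : Set F'), (∀ Q : (∀ F₁ : AlgebraicGeometry.Scheme.{0}, (F₁ ⟶ F₂) → Set F₁ → Prop), Q F₂ (CategoryTheory.CategoryStruct.id F₂) (closure (υ ⁻¹' (Set.range ι \ {y : (Literature.AlgebraicGeometry.Motives.projectiveSpace n k).left | ∀ i, f i ∈ (y : ProjectiveSpectrum (MvPolynomial.homogeneousSubmodule (Fin (n + 1)) k)).asHomogeneousIdeal}))) → (∀ (F₁ F₃ : AlgebraicGeometry.Scheme.{0}) (ρ : F₁ ⟶ F₂) (T₁ : Set F₁) (x : ↥((AlgebraicGeometry.Scheme.IdealSheafData.vanishingIdeal (⟨closure T₁, isClosed_closure⟩ : TopologicalSpace.Closeds F₁))).subscheme) (υ₁ : F₃ ⟶ F₁) (hx : IsClosed ({(((AlgebraicGeometry.Scheme.IdealSheafData.vanishingIdeal (⟨closure T₁, isClosed_closure⟩ : TopologicalSpace.Closeds F₁))).subschemeι x : F₁)} :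 Set F₁)), Q F₁ ρ T₁ → ¬ IsRegularLocalRing (((AlgebraicGeometry.Scheme.IdealSheafData.vanishingIdeal (⟨closure T₁, isClosed_closure⟩ : TopologicalSpace.Closeds F₁))).subscheme.presheaf.stalk x) → Literature.AlgebraicGeometry.Resolution.IsBlowup υ₁ (AlgebraicGeometry.Scheme.IdealSheafData.vanishingIdeal (⟨{(((AlgebraicGeometry.Scheme.IdealSheafData.vanishingIdeal (⟨closure T₁, isClosed_closure⟩ : TopologicalSpace.Closeds F₁))).subschemeι x : F₁)}, hx⟩ : TopologicalSpace.Closeds F₁)) → Q F₃ (CategoryTheory.CategoryStruct.comp υ₁ ρ) (closure (υ₁ ⁻¹' (T₁ \ {(((AlgebraicGeometry.Scheme.IdealSheafData.vanishingIdeal (⟨closure T₁, isClosed_closure⟩ : TopologicalSpace.Closeds F₁))).subschemeι x : F₁)})))) → Q F' ρ' T') ∧ Literature.AlgebraicGeometry.Resolution.Scheme.IsRegular (AlgebraicGeometry.Scheme.IdealSheafData.vanishingIdeal (⟨closure T', isClosed_closure⟩ : TopologicalSpace.Closeds F')).subscheme) → ∃ (O : Type) (_ : CommRing O) (_ : IsDomain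 O) (_ : IsDiscreteValuationRing O) (_ : CharZero O) (π : O →+* k), Function.Surjective π ∧ (letI := MvPolynomial.gradedAlgebra (σ := Fin (n + 1)) (R := O); letI := MvPolynomial.gradedAlgebra (σ := Fin (n + 1)) (R := k); ∀ (φ : MvPolynomial.homogeneousSubmodule (Fin (n + 1)) O →+*ᵍ MvPolynomial.homogeneousSubmodule (Fin (n + 1)) k) (hφ' : HomogeneousIdeal.irrelevant (MvPolynomial.homogeneousSubmodule (Fin (n + 1)) k) ≤ (HomogeneousIdeal.irrelevant (MvPolynomial.homogeneousSubmodule (Fin (n + 1)) O)).map φ), (∀ s, φ s = MvPolynomial.map π s) → ∀ Y : Set (AlgebraicGeometry.Proj (MvPolynomial.homogeneousSubmodule (Fin (n + 1)) O)), Y = Set.range (CategoryTheory.CategoryStruct.comp ι (AlgebraicGeometry.Proj.map φ hφ') : H ⟶ (AlgebraicGeometry.Proj (MvPolynomial.homogeneousSubmodule (Fin (n + 1)) O))) → ∃ (P' : AlgebraicGeometry.Scheme.{0}) (σ : P' ⟶ (AlgebraicGeometry.Proj (MvPolynomial.homogeneousSubmodule (Fin (n + 1)) O))) (S' : Set P'),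 (∀ Q : (∀ X' : AlgebraicGeometry.Scheme.{0}, (X' ⟶ (AlgebraicGeometry.Proj (MvPolynomial.homogeneousSubmodule (Fin (n + 1)) O))) → Set X' → Prop), Q (AlgebraicGeometry.Proj (MvPolynomial.homogeneousSubmodule (Fin (n + 1)) O)) (CategoryTheory.CategoryStruct.id (AlgebraicGeometry.Proj (MvPolynomial.homogeneousSubmodule (Fin (n + 1)) O))) Y → (∀ (X' X'' : AlgebraicGeometry.Scheme.{0}) (σ' : X' ⟶ (AlgebraicGeometry.Proj (MvPolynomial.homogeneousSubmodule (Fin (n + 1)) O))) (Y' : Set X') (C : X'.IdealSheafData) (τ : X'' ⟶ X'), Q X' σ' Y' → Literature.AlgebraicGeometry.Resolution.IsBlowup τ C → Literature.AlgebraicGeometry.Resolution.Scheme.IsRegular C.subscheme → AlgebraicGeometry.Flat (CategoryTheory.CategoryStruct.comp C.subschemeι (CategoryTheory.CategoryStruct.comp σ' (CategoryTheory.CategoryStruct.comp (AlgebraicGeometry.Proj.toSpecZero (MvPolynomial.homogeneousSubmodule (Fin (n + 1)) O)) (AlgebraicGeometry.Spec.map (CommRingCat.ofHom (algebraMap O (MvPolynomial.homogeneousSubmodule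 (Fin (n + 1)) O 0))))))) → σ' '' (C.support : Set X') ⊆ {x | ¬ IsGenericPoint x Y} → (C.support : Set X') ∩ (CategoryTheory.CategoryStruct.comp σ' (CategoryTheory.CategoryStruct.comp (AlgebraicGeometry.Proj.toSpecZero (MvPolynomial.homogeneousSubmodule (Fin (n + 1)) O)) (AlgebraicGeometry.Spec.map (CommRingCat.ofHom (algebraMap O (MvPolynomial.homogeneousSubmodule (Fin (n + 1)) O 0)))))) ⁻¹' {IsLocalRing.closedPoint O} ⊆ Y' → Q X'' (CategoryTheory.CategoryStruct.comp τ σ') (closure (τ ⁻¹' (Y' \ (C.support : Set X'))))) → Q P' σ S') ∧ Literature.AlgebraicGeometry.Resolution.Scheme.IsRegular (AlgebraicGeometry.Scheme.IdealSheafData.vanishingIdeal (⟨closure S', isClosed_closure⟩ : TopologicalSpace.Closeds P')).subscheme)  := by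
  classical
  intro hp k _ _ _ n H ι hι hH hloc hLIFT hHORIZ hci
  obtain ⟨c, f, d, hfd, hne, hsub, hnsub, hjac, hSig, F₂, υ, hυ, hdown⟩ := hci
  obtain ⟨O, i1, i2, i3, i4, i5, i6, π, hπ⟩ := stub_wittRing p hp k
  obtain ⟨C, hCsm, hKEY⟩ := hLIFT O π hπ c f d hfd hne hjac hSig
  refine ⟨O, i1, i2, i3, i4, π, hπ, ?_⟩
  intro φ hφ' hφ Y hY
  have hK := hKEY φ hφ' hφ
  refine hHORIZ O π hπ φ hφ' hφ C hCsm ?_ ?_ ?_ Y hY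
  · rw [hK]; erw [AlgebraicGeometry.Scheme.IdealSheafData.coe_support_vanishingIdeal]; exact hnsub
  · rw [hK]; erw [AlgebraicGeometry.Scheme.IdealSheafData.coe_support_vanishingIdeal]; exact hsub
  · refine ⟨F₂, υ, ?_, ?_⟩
    · rw [hK]; exact hυ
    · rw [hK]; erw [AlgebraicGeometry.Scheme.IdealSheafData.coe_support_vanishingIdeal]; exact hdown

end Summit.ResolutionOfSingularities.ResolutionOfSingularities.Cruxes.EquisingularLiftNat.Sections
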